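import Summits.CriticalPhenomena.SAWScalingLimit.Theorems.SAWLoopFugacityFlowAvoidanceLimitShieldN
import HarnessLib

/-!
# The shielding lemma (corrected Chelkak 2016, Lemma 2.14), north-eastward slit

Sub-problem `CriticalPhenomena/SAWScalingLimit`, crux `AvoidanceLimit`, line `symplectic-fermion-anchor`
(lead c5, §shield). `shield_NE` is the diagonal companion of `shield_N` (see that file for the proof
scheme): slit in the wedge `7X - 17Y ≤ 23 ∧ 7Y - 17X ≤ 23`, one vertical slit edge in the row `30k` and
one horizontal one in the column `30k` (staircase order), box `mW c k` with `c = x̂₁ + (6k, 6k)`, cap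
`17X + 7Y ≥ 64k ∧ 7X + 17Y ≥ 64k`, start sites `c + (24k, -5k)` / `c + (-5k, 24k)`, cores
`shieldCore_NEcw` / `shieldCore_NEccw`; the jump is taken across the first slit edge leaving
`|· - x̂₁|_∞ ≤ 30k`. [cite: Chelkak2016, Lemma 2.14]
-/

noncomputable section

open scoped BigOperators Classical
open Set Complex SimpleGraph Metric
open Literature.Topology.PlaneTopology
open Literature.Probability.Percolation (walkWinding StepKind stepKind_of_adj)
open Literature.Probability.LatticeModels
open Literature.Probability.RandomPlanarGeometry (JordanDomain)

namespace Summit.CriticalPhenomena.SAWScalingLimit.Theorems.AvoidanceLimit.Anchor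

/-- The circuit constant of design NE-cw is at most one. [folklore] -/
theorem circNEcwConst_le_one : circNEcwConst ≤ 1 :=
  (circNEcwConst_le_chainM (c := 0) (k := 1) one_pos (![24, -5]) (circNEcw_start 0 1 one_pos _ (by simp) (by simp) (by simp)
    (by simp))).trans (chainM_mem_Icc (circNEcwU_finite 0 1) 10 _).2

set_option maxHeartbeats 1600000 in
/-- **The shielding lemma, north-eastward slit.** See the module docstring. [cite: Chelkak2016, Lemma 2.14] -/
theorem shield_NE :
    ∀ (D : JordanDomain) (b : ℂ) (s : ℝ) (hs : 0 < s) (g o : ℂ) (δ : ℝ), 0 < δ →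
    ∀ (H : Site 2 → ℝ) (S₀ : Set (Site 2)) (CH : ℝ), S₀ ⊆ germSites D b hs g o δ → (∀ w, 0 ≤ H w) →
      IsKilledHarmonicOn (discreteDomainGraph D.carrier δ) H S₀ →
    ∀ (x₁ pp c : Site 2) (k : ℕ), 5 ≤ k → c 0 = x₁ 0 + 6 * k → c 1 = x₁ 1 + 6 * k →
      (∀ z ∈ germGate D b hs g o, (48 * k + 2) * δ < |z.re - δ * c 0| ∨ (48 * k + 2) * δ < |z.im - δ * c 1|) →
      (∀ z ∈ germSites D b hs g o δ, z ∈ mW c k → z ∈ S₀) →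
      (∀ w : Site 2, |w 0 - c 0| ≤ 48 * k → |w 1 - c 1| ≤ 48 * k →
        64 * (k : ℤ) ≤ 17 * (w 0 - x₁ 0) + 7 * (w 1 - x₁ 1) → 64 * (k : ℤ) ≤ 7 * (w 0 - x₁ 0) + 17 * (w 1 - x₁ 1) →
        w ∈ germSites D b hs g o δ ∧ ∀ e : SRW.Dir 2, (discreteDomainGraph D.carrier δ).Adj w (w + SRW.stepVec e)) →
      (∀ w : Site 2, |w 0 - c 0| ≤ 48 * k → |w 1 - c 1| ≤ 48 * k →
        64 * (k : ℤ) ≤ 17 * (w 0 - x₁ 0) + 7 * (w 1 - x₁ 1) → 64 * (k : ℤ) ≤ 7 * (w 0 - x₁ 0) + 17 * (w 1 - x₁ 1) →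
        H w ≤ CH * H pp) →
    ∀ (L : (discreteDomainGraph D.carrier δ).Walk x₁ pp), L.IsPath →
      (∀ z ∈ L.support, -2 ≤ z 0 - x₁ 0 ∧ -2 ≤ z 1 - x₁ 1 ∧
        7 * (z 0 - x₁ 0) - 17 * (z 1 - x₁ 1) ≤ 23 ∧ 7 * (z 1 - x₁ 1) - 17 * (z 0 - x₁ 0) ≤ 23) →
    ∀ (X₀ Yc : ℤ),
      s((![X₀, x₁ 1 + 30 * k] : Site 2), ![X₀, x₁ 1 + 30 * k + 1]) ∈ L.edges →
      (∀ X : ℤ, s((![X, x₁ 1 + 30 * k] : Site 2), ![X, x₁ 1 + 30 * k + 1]) ∈ L.edges → X = X₀) →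
      s((![x₁ 0 + 30 * k, Yc] : Site 2), ![x₁ 0 + 30 * k + 1, Yc]) ∈ L.edges →
      (∀ Y : ℤ, s((![x₁ 0 + 30 * k, Y] : Site 2), ![x₁ 0 + 30 * k + 1, Y]) ∈ L.edges → Y = Yc) →
      (X₀ ≤ x₁ 0 + 30 * k → x₁ 1 + 30 * k + 1 ≤ Yc) → (x₁ 0 + 30 * k + 1 ≤ X₀ → Yc ≤ x₁ 1 + 30 * k) →
    ∀ (v₀ wend : Site 2) (In : (discreteDomainGraph D.carrier δ).Walk x₁ v₀)
      (γ : (discreteDomainGraph D.carrier δ).Walk v₀ wend) (Far : (discreteDomainGraph D.carrier δ).Walk wend pp),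
      |v₀ 0 - x₁ 0| ≤ k → |v₀ 1 - x₁ 1| ≤ k →
      (∀ z ∈ In.support, |z 0 - x₁ 0| ≤ 2 * k ∧ |z 1 - x₁ 1| ≤ 2 * k) →
      (∀ z ∈ γ.support, z = wend ∨ (z ∈ S₀ ∧ H v₀ ≤ H z)) → H v₀ ≤ H wend →
      (∀ z ∈ Far.support, 48 * (k : ℤ) < |z 0 - c 0| ∨ 48 * (k : ℤ) < |z 1 - c 1|) →
      min circNEcwConst circNEccwConst * H v₀ ≤ CH * H pp := by
  intro D b s hs g o δ hδ H S₀ CH hS₀Θ hH0 hHarm x₁ pp c k hk hc0 hc1 hgate hΘS₀ hcap hHar L hLpath hLwedge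
    X₀ Yc hX₀mem hX₀uniq hYcmem hYcuniq hordA hordB v₀ wend In γ Far hv00 hv01 hIn hγ hwend hFar
  have hk0 : 0 < k := by omega
  have hle : discreteDomainGraph D.carrier δ ≤ zdGraph 2 :=
    (discreteDomainGraph_le_meshGraph _ _).trans (meshGraph_le_zdGraph _ _)
  have hmin_le_one : min circNEcwConst circNEccwConst ≤ 1 := (min_le_left _ _).trans circNEcwConst_le_one
  have hm0 : 0 ≤ H v₀ := hH0 v₀
  have hwend_out : 48 * (k : ℤ) < |wend 0 - c 0| ∨ 48 * (k : ℤ) < |wend 1 - c 1| := hFar wend (Walk.start_mem_support Far)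
  by_cases hcase : ∃ z ∈ γ.support, |z 0 - c 0| ≤ 48 * k ∧ |z 1 - c 1| ≤ 48 * k ∧
      64 * (k : ℤ) ≤ 17 * (z 0 - x₁ 0) + 7 * (z 1 - x₁ 1) ∧ 64 * (k : ℤ) ≤ 7 * (z 0 - x₁ 0) + 17 * (z 1 - x₁ 1)
  · obtain ⟨z, hzγ, hz0, hz1, hzc, hzc'⟩ := hcase
    have hzne : z ≠ wend := by
      rintro rfl; rcases hwend_out with h | h <;> omega
    have hHz : H v₀ ≤ H z := by
      rcases hγ z hzγ with h | h
      · exact absurd h hzne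
      · exact h.2
    calc min circNEcwConst circNEccwConst * H v₀ ≤ 1 * H v₀ := mul_le_mul_of_nonneg_right hmin_le_one hm0
      _ = H v₀ := one_mul _
      _ ≤ H z := hHz
      _ ≤ CH * H pp := hHar z hz0 hz1 hzc hzc'
  push Not at hcase
  set lam : (discreteDomainGraph D.carrier δ).Walk x₁ x₁ := (In.append (γ.append Far)).append L.reverse with hlamdef
  set lam' := lam.mapLe hle with hlam'
  have hsupp' : lam'.support = lam.support := Walk.support_mapLe_eq_support hle lam
  have hmem_lam : ∀ t, t ∈ lam.support ↔ t ∈ In.support ∨ t ∈ γ.support ∨ t ∈ Far.support ∨ t ∈ L.support := by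
    intro t
    simp only [hlamdef, Walk.mem_support_append_iff, Walk.support_reverse, List.mem_reverse]
    tauto
  -- vertices of `lam` in the box: on `γ`, in the germ box, or in the wedge
  have hvert : ∀ t ∈ lam.support, t ∈ mW c k →
      t ∈ γ.support ∨ (-8 * (k : ℤ) ≤ t 0 - c 0 ∧ t 0 - c 0 ≤ -4 * k ∧ -8 * (k : ℤ) ≤ t 1 - c 1 ∧ t 1 - c 1 ≤ -4 * k) ∨
        (-2 ≤ t 0 - c 0 + 6 * k ∧ -2 ≤ t 1 - c 1 + 6 * k ∧
          7 * (t 0 - c 0 + 6 * k) - 17 * (t 1 - c 1 + 6 * k) ≤ 23 ∧ 7 * (t 1 - c 1 + 6 * k) - 17 * (t 0 - c 0 + 6 * k) ≤ 23) := by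
    intro t ht htW
    have htW' : |t 0 - c 0| ≤ 48 * k ∧ |t 1 - c 1| ≤ 48 * k := by simpa [mW] using htW
    rcases (hmem_lam t).1 ht with h | h | h | h
    · right; left
      obtain ⟨h0, h1⟩ := hIn t h
      rw [abs_le] at h0 h1
      refine ⟨by omega, by omega, by omega, by omega⟩
    · exact Or.inl h
    · rcases hFar t h with h' | h' <;> omega
    · right; right
      obtain ⟨h1, h2, h3, h4⟩ := hLwedge t h
      refine ⟨by omega, by omega, by omega, by omega⟩
  -- all vertices of `lam` are sites of `Ω_δ`
  have hx₁W : |x₁ 0 - c 0| ≤ 48 * k ∧ |x₁ 1 - c 1| ≤ 48 * k := by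
    rw [hc0, hc1, abs_le, abs_le]; refine ⟨⟨?_, ?_⟩, ?_, ?_⟩ <;> omega
  have hx₁D : x₁ ∈ meshDomain D.carrier δ := by
    have hne : x₁ ≠ pp := by
      intro h
      rcases hFar pp (Walk.end_mem_support Far) with h' | h' <;> rw [← h] at h' <;> omega
    cases L with
    | nil => exact absurd rfl hne
    | cons h p => exact (discreteDomainGraph_adj_iff.1 h).2.1
  have hlamD : ∀ t ∈ lam.support, t ∈ meshDomain D.carrier δ :=
    mem_meshDomain_of_mem_support' lam hx₁D
  -- notation for the row, the column and their offsets
  set Yr : ℤ := x₁ 1 + 30 * k with hYr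
  set Xc : ℤ := x₁ 0 + 30 * k with hXc
  -- cap membership and box membership of the sites used below
  have hcapXY : ∀ X Y : ℤ, k ≤ X - x₁ 0 → X - x₁ 0 ≤ 30 * k + 1 → k ≤ Y - x₁ 1 → Y - x₁ 1 ≤ 30 * k + 1 →
      (12 * (k : ℤ) ≤ X - x₁ 0 ∨ 12 * (k : ℤ) ≤ Y - x₁ 1) →
      (64 * (k : ℤ) ≤ 17 * ((![X, Y] : Site 2) 0 - x₁ 0) + 7 * ((![X, Y] : Site 2) 1 - x₁ 1) ∧
        64 * (k : ℤ) ≤ 7 * ((![X, Y] : Site 2) 0 - x₁ 0) + 17 * ((![X, Y] : Site 2) 1 - x₁ 1)) ∧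
      (![X, Y] : Site 2) ∈ mW c k := by
    intro X Y h1 h2 h3 h4 h5
    simp only [Matrix.cons_val_zero, Matrix.cons_val_one, mW, mem_setOf_eq, hc0, hc1]
    refine ⟨⟨by omega, by omega⟩, by rw [abs_le]; constructor <;> omega, by rw [abs_le]; constructor <;> omega⟩
  -- a cap site of the box is not a vertex of `In`, `γ`, `Far`
  have hnotIn : ∀ t : Site 2, 3 * (k : ℤ) ≤ t 1 - x₁ 1 ∨ 3 * (k : ℤ) ≤ t 0 - x₁ 0 → t ∉ In.support := by
    intro t ht hmem
    obtain ⟨h0, h1⟩ := hIn t hmem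
    rw [abs_le] at h0 h1
    omega
  have hnotγ : ∀ t : Site 2, t ∈ mW c k →
      64 * (k : ℤ) ≤ 17 * (t 0 - x₁ 0) + 7 * (t 1 - x₁ 1) → 64 * (k : ℤ) ≤ 7 * (t 0 - x₁ 0) + 17 * (t 1 - x₁ 1) →
      t ∉ γ.support := by
    intro t htW ht ht' hmem
    have htW' : |t 0 - c 0| ≤ 48 * k ∧ |t 1 - c 1| ≤ 48 * k := by simpa [mW] using htW
    have := hcase t hmem htW'.1 htW'.2
    omega
  have hnotFar : ∀ t : Site 2, t ∈ mW c k → t ∉ Far.support := by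
    intro t htW hmem
    have htW' : |t 0 - c 0| ≤ 48 * k ∧ |t 1 - c 1| ≤ 48 * k := by simpa [mW] using htW
    rcases hFar t hmem with h | h <;> omega
  -- bounds on the slit edges from the wedge
  have hX₀bd : 12 * (k : ℤ) ≤ X₀ - x₁ 0 ∧ X₀ - x₁ 0 ≤ 73 * k + 2 := by
    have hv := hLwedge _ (Walk.fst_mem_support_of_mem_edges L hX₀mem)
    simp only [Matrix.cons_val_zero, Matrix.cons_val_one] at hv
    constructor <;> omega
  have hYcbd : 12 * (k : ℤ) ≤ Yc - x₁ 1 ∧ Yc - x₁ 1 ≤ 73 * k + 2 := by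
    have hv := hLwedge _ (Walk.fst_mem_support_of_mem_edges L hYcmem)
    simp only [Matrix.cons_val_zero, Matrix.cons_val_one] at hv
    constructor <;> omega
  -- the edges of `lam`
  have hedges : lam.edges = In.edges ++ (γ.edges ++ Far.edges) ++ L.edges.reverse := by
    simp only [hlamdef, Walk.edges_append, Walk.edges_reverse]
  -- vertical edges of the row `Yr` with `k ≤ X - x₁₀ ≤ 30k`, horizontal edges of the column `Xc` with `k ≤ Y - x₁₁ ≤ 30k`:
  -- they are not edges of `In`, `γ`, `Far`
  have hvedge : ∀ X : ℤ, k ≤ X - x₁ 0 → X - x₁ 0 ≤ 30 * k →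
      (s((![X, Yr] : Site 2), ![X, Yr + 1]) ∈ In.edges → False) ∧
      (s((![X, Yr] : Site 2), ![X, Yr + 1]) ∈ γ.edges → False) ∧
      (s((![X, Yr] : Site 2), ![X, Yr + 1]) ∈ Far.edges → False) := by
    intro X h1 h2
    obtain ⟨hc, hW⟩ := hcapXY X Yr h1 (by omega) (by omega) (by omega) (Or.inr (by omega))
    refine ⟨fun h => ?_, fun h => ?_, fun h => ?_⟩
    · exact hnotIn _ (Or.inl (by simp only [Matrix.cons_val_one, Matrix.cons_val_fin_one]; omega))
        (Walk.fst_mem_support_of_mem_edges In h)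
    · exact hnotγ _ hW hc.1 hc.2 (Walk.fst_mem_support_of_mem_edges γ h)
    · exact hnotFar _ hW (Walk.fst_mem_support_of_mem_edges Far h)
  have hhedge : ∀ Y : ℤ, k ≤ Y - x₁ 1 → Y - x₁ 1 ≤ 30 * k →
      (s((![Xc, Y] : Site 2), ![Xc + 1, Y]) ∈ In.edges → False) ∧
      (s((![Xc, Y] : Site 2), ![Xc + 1, Y]) ∈ γ.edges → False) ∧
      (s((![Xc, Y] : Site 2), ![Xc + 1, Y]) ∈ Far.edges → False) := by
    intro Y h1 h2
    obtain ⟨hc, hW⟩ := hcapXY Xc Y (by omega) (by omega) h1 (by omega) (Or.inl (by omega))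
    refine ⟨fun h => ?_, fun h => ?_, fun h => ?_⟩
    · exact hnotIn _ (Or.inr (by simp only [Matrix.cons_val_zero]; omega)) (Walk.fst_mem_support_of_mem_edges In h)
    · exact hnotγ _ hW hc.1 hc.2 (Walk.fst_mem_support_of_mem_edges γ h)
    · exact hnotFar _ hW (Walk.fst_mem_support_of_mem_edges Far h)
  -- membership of such edges in `lam'`
  have hvmem : ∀ X : ℤ, k ≤ X - x₁ 0 → X - x₁ 0 ≤ 30 * k →
      (s((![X, Yr] : Site 2), ![X, Yr + 1]) ∈ lam'.edges ↔ X = X₀) := by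
    intro X h1 h2
    obtain ⟨i1, i2, i3⟩ := hvedge X h1 h2
    rw [hlam', Walk.edges_mapLe_eq_edges, hedges, List.mem_append, List.mem_append, List.mem_append, List.mem_reverse]
    constructor
    · rintro ((h | h | h) | h)
      · exact (i1 h).elim
      · exact (i2 h).elim
      · exact (i3 h).elim
      · exact hX₀uniq X h
    · rintro rfl; exact Or.inr hX₀mem
  have hhmem : ∀ Y : ℤ, k ≤ Y - x₁ 1 → Y - x₁ 1 ≤ 30 * k →
      (s((![Xc, Y] : Site 2), ![Xc + 1, Y]) ∈ lam'.edges ↔ Y = Yc) := by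
    intro Y h1 h2
    obtain ⟨i1, i2, i3⟩ := hhedge Y h1 h2
    rw [hlam', Walk.edges_mapLe_eq_edges, hedges, List.mem_append, List.mem_append, List.mem_append, List.mem_reverse]
    constructor
    · rintro ((h | h | h) | h)
      · exact (i1 h).elim
      · exact (i2 h).elim
      · exact (i3 h).elim
      · exact hYcuniq Y h
    · rintro rfl; exact Or.inr hYcmem
  have hLedges_nodup : L.edges.Nodup := Walk.edges_nodup_of_support_nodup hLpath.support_nodup
  -- the two start faces and the winding numbers there
  set wcw := walkWinding lam' ![Xc, x₁ 1 + k] with hwcw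
  set wccw := walkWinding lam' ![x₁ 0 + k, Yr] with hwccw
  have hdiff : |wccw - wcw| = 1 := by
    by_cases hA : X₀ ≤ x₁ 0 + 30 * k
    · -- Case A: the vertical slit edge of the row lies in the box; jump across it
      have hYc := hordA hA
      have hcount : lam'.edges.count s((![X₀, Yr] : Site 2), ![X₀, Yr + 1]) = 1 := by
        obtain ⟨i1, i2, i3⟩ := hvedge X₀ (by omega) (by omega)
        rw [hlam', Walk.edges_mapLe_eq_edges, hedges]
        rw [List.count_append, List.count_append, List.count_append, List.count_reverse,
          List.count_eq_zero.2 (fun h => i1 h), List.count_eq_zero.2 (fun h => i2 h), List.count_eq_zero.2 (fun h => i3 h),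
          List.count_eq_one_of_mem hLedges_nodup hX₀mem]
      have hjump : |walkWinding lam' ![X₀ - 1, Yr] - walkWinding lam' ![X₀, Yr]| = 1 := by
        have e1 : (![X₀ - 1, Yr] : Site 2) + Pi.single 0 1 = ![X₀, Yr] := by
          ext i; fin_cases i <;> simp [sub_add_cancel]
        have e2 : (![X₀, Yr] : Site 2) + Pi.single 1 1 = ![X₀, Yr + 1] := by
          ext i; fin_cases i <;> simp
        have key := abs_walkWinding_sub_right_of_count_eq_one lam' ![X₀ - 1, Yr] (by rw [e1, e2]; exact hcount)
        rwa [e1] at key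
      -- leftward along the row to `(x₁₀ + k, Yr)`
      have hrowL : wccw = walkWinding lam' ![X₀ - 1, Yr] := by
        have hn : (X₀ - 1 - (x₁ 0 + k)).toNat = X₀ - 1 - (x₁ 0 + k) := Int.toNat_of_nonneg (by omega)
        have key := walkWinding_row_eq lam' (x₁ 0 + k) Yr (X₀ - 1 - (x₁ 0 + k)).toNat (fun j hj hjn => by
          intro h
          have := (hvmem (x₁ 0 + k + j) (by omega) (by omega)).1 (by exact_mod_cast h)
          omega)
        rw [hn, add_sub_cancel] at key
        exact key
      -- rightward along the row to `(Xc, Yr)`, then down the column to `(Xc, x₁₁ + k)`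
      have hrowR : walkWinding lam' ![X₀, Yr] = walkWinding lam' ![Xc, Yr] := by
        have hn : (Xc - X₀).toNat = Xc - X₀ := Int.toNat_of_nonneg (by omega)
        have key := walkWinding_row_eq lam' X₀ Yr (Xc - X₀).toNat (fun j hj hjn => by
          intro h
          have := (hvmem (X₀ + j) (by omega) (by omega)).1 (by exact_mod_cast h)
          omega)
        rw [hn, add_sub_cancel] at key
        exact key
      have hcol : wcw = walkWinding lam' ![Xc, Yr] := by
        have hn : (Yr - (x₁ 1 + k)).toNat = Yr - (x₁ 1 + k) := Int.toNat_of_nonneg (by omega)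
        have key := walkWinding_col_eq lam' Xc (x₁ 1 + k) (Yr - (x₁ 1 + k)).toNat (fun j hj hjn => by
          intro h
          have := (hhmem (x₁ 1 + k + j) (by omega) (by omega)).1 (by exact_mod_cast h)
          omega)
        rw [hn, add_sub_cancel] at key
        exact key
      rw [hrowL, hcol, ← hrowR]
      exact hjump
    · -- Case B: the horizontal slit edge of the column lies in the box; jump across it
      push Not at hA
      have hYc := hordB (by omega)
      have hcount : lam'.edges.count s((![Xc, Yc] : Site 2), ![Xc + 1, Yc]) = 1 := by
        obtain ⟨i1, i2, i3⟩ := hhedge Yc (by omega) (by omega)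
        rw [hlam', Walk.edges_mapLe_eq_edges, hedges]
        rw [List.count_append, List.count_append, List.count_append, List.count_reverse,
          List.count_eq_zero.2 (fun h => i1 h), List.count_eq_zero.2 (fun h => i2 h), List.count_eq_zero.2 (fun h => i3 h),
          List.count_eq_one_of_mem hLedges_nodup hYcmem]
      have hjump : |walkWinding lam' ![Xc, Yc - 1] - walkWinding lam' ![Xc, Yc]| = 1 := by
        have e1 : (![Xc, Yc - 1] : Site 2) + Pi.single 1 1 = ![Xc, Yc] := by
          ext i; fin_cases i <;> simp [sub_add_cancel]
        have e2 : (![Xc, Yc] : Site 2) + Pi.single 0 1 = ![Xc + 1, Yc] := by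
          ext i; fin_cases i <;> simp
        have key := abs_walkWinding_sub_up_of_count_eq_one lam' ![Xc, Yc - 1] (by rw [e1, e2]; exact hcount)
        rwa [e1] at key
      -- down the column to `(Xc, x₁₁ + k)`
      have hcolD : wcw = walkWinding lam' ![Xc, Yc - 1] := by
        have hn : (Yc - 1 - (x₁ 1 + k)).toNat = Yc - 1 - (x₁ 1 + k) := Int.toNat_of_nonneg (by omega)
        have key := walkWinding_col_eq lam' Xc (x₁ 1 + k) (Yc - 1 - (x₁ 1 + k)).toNat (fun j hj hjn => by
          intro h
          have := (hhmem (x₁ 1 + k + j) (by omega) (by omega)).1 (by exact_mod_cast h)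
          omega)
        rw [hn, add_sub_cancel] at key
        exact key
      -- up the column to `(Xc, Yr)`, then leftward along the row to `(x₁₀ + k, Yr)`
      have hcolU : walkWinding lam' ![Xc, Yc] = walkWinding lam' ![Xc, Yr] := by
        have hn : (Yr - Yc).toNat = Yr - Yc := Int.toNat_of_nonneg (by omega)
        have key := walkWinding_col_eq lam' Xc Yc (Yr - Yc).toNat (fun j hj hjn => by
          intro h
          have := (hhmem (Yc + j) (by omega) (by omega)).1 (by exact_mod_cast h)
          omega)
        rw [hn, add_sub_cancel] at key
        exact key
      have hrow : wccw = walkWinding lam' ![Xc, Yr] := by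
        have hn : (Xc - (x₁ 0 + k)).toNat = Xc - (x₁ 0 + k) := Int.toNat_of_nonneg (by omega)
        have key := walkWinding_row_eq lam' (x₁ 0 + k) Yr (Xc - (x₁ 0 + k)).toNat (fun j hj hjn => by
          intro h
          have := (hvmem (x₁ 0 + k + j) (by omega) (by omega)).1 (by exact_mod_cast h)
          omega)
        rw [hn, add_sub_cancel] at key
        exact key
      rw [hrow, ← hcolU, hcolD, abs_sub_comm]
      exact hjump
  -- one of the two start sites has nonzero winding number
  have hstart : ∃ u : Site 2, walkWinding lam' u ≠ 0 ∧
      ((u 0 = Xc ∧ u 1 = x₁ 1 + k) ∨ (u 0 = x₁ 0 + k ∧ u 1 = Yr)) := by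
    by_cases hR : wcw ≠ 0
    · exact ⟨_, hR, Or.inl ⟨by simp, by simp⟩⟩
    · push Not at hR
      refine ⟨![x₁ 0 + k, Yr], ?_, Or.inr ⟨by simp, by simp⟩⟩
      intro h0
      rw [show wccw = walkWinding lam' ![x₁ 0 + k, Yr] from rfl] at hdiff
      rw [hR, h0] at hdiff
      simp at hdiff
  obtain ⟨u, huw, hu⟩ := hstart
  -- the start site is a clean cap site of the box, off the loop
  have hucoord : (u 0 - x₁ 0 = 30 * k ∧ u 1 - x₁ 1 = k) ∨ (u 0 - x₁ 0 = k ∧ u 1 - x₁ 1 = 30 * k) := by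
    rcases hu with ⟨h0, h1⟩ | ⟨h0, h1⟩
    · left; rw [h0, h1, hXc]; constructor <;> ring
    · right; rw [h0, h1, hYr]; constructor <;> ring
  have hucap : 64 * (k : ℤ) ≤ 17 * (u 0 - x₁ 0) + 7 * (u 1 - x₁ 1) ∧ 64 * (k : ℤ) ≤ 7 * (u 0 - x₁ 0) + 17 * (u 1 - x₁ 1) := by
    rcases hucoord with ⟨h0, h1⟩ | ⟨h0, h1⟩ <;> rw [h0, h1] <;> constructor <;> omega
  have huc0 : |u 0 - c 0| ≤ 48 * k := by
    rw [hc0, abs_le]; rcases hucoord with ⟨h0, -⟩ | ⟨h0, -⟩ <;> constructor <;> omega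
  have huc1 : |u 1 - c 1| ≤ 48 * k := by
    rw [hc1, abs_le]; rcases hucoord with ⟨-, h1⟩ | ⟨-, h1⟩ <;> constructor <;> omega
  have huW : u ∈ mW c k := by simp only [mW, mem_setOf_eq]; exact ⟨huc0, huc1⟩
  obtain ⟨huΘ, huadj⟩ := hcap u huc0 huc1 hucap.1 hucap.2
  have hunot : u ∉ lam.support := by
    intro h
    rcases hvert u h huW with h' | h' | h'
    · exact hnotγ u huW hucap.1 hucap.2 h'
    · obtain ⟨_, h2, _, h4⟩ := h'
      rw [hc0] at h2; rcases hucoord with ⟨h0, -⟩ | ⟨h0, -⟩ <;> omega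
    · obtain ⟨_, _, h3, h4⟩ := h'
      rw [hc0, hc1] at h3 h4; rcases hucoord with ⟨h0, h1⟩ | ⟨h0, h1⟩ <;> omega
  have hunot' : u ∉ lam'.support := by rwa [hsupp']
  -- the certified sites
  obtain ⟨S, hSin, hSΘ, hSW, hSnot, hSadj, hScl⟩ := certified_package D b s hs g o δ hδ lam c k hlamD hgate
  have huS : u ∈ S := hSin u hunot huw huW huΘ
  -- the target set and its crossing
  set A : Set (Site 2) := {z | z ∈ (γ.mapLe hle).support} with hA
  have hAγ : ∀ z, z ∈ A ↔ z ∈ γ.support := fun z => by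
    rw [hA, mem_setOf_eq, Walk.support_mapLe_eq_support]
  have hcross := aCrossing_NE c x₁ k hk0 hc0 hc1 (γ.mapLe hle) hv00 hv01 hwend_out (fun z hz hz0 hz1 => by
    rw [Walk.support_mapLe_eq_support] at hz
    have := hcase z hz hz0 hz1
    omega)
  -- hypotheses of the lattice core
  have hΘfin : S₀.Finite := (germSites_finite hδ).subset hS₀Θ
  have hSA : Disjoint S A := by
    rw [Set.disjoint_left]
    intro v hv hvA
    exact hSnot v hv ((hmem_lam v).2 (Or.inr (Or.inl ((hAγ v).1 hvA))))
  have hSS₀ : S ⊆ S₀ := fun v hv => hΘS₀ v (hSΘ hv) (hSW hv)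
  have hcl : ∀ v ∈ S, ∀ kk : Fin 4, v + cornerUnit kk ∈ mW c k →
      v + cornerUnit kk ∈ S ∨ v + cornerUnit kk ∈ A ∨
        (-8 * (k : ℤ) ≤ (v + cornerUnit kk) 0 - c 0 ∧ (v + cornerUnit kk) 0 - c 0 ≤ -4 * k ∧
            -8 * (k : ℤ) ≤ (v + cornerUnit kk) 1 - c 1 ∧ (v + cornerUnit kk) 1 - c 1 ≤ -4 * k) ∨
        (-2 ≤ (v + cornerUnit kk) 0 - c 0 + 6 * k ∧ -2 ≤ (v + cornerUnit kk) 1 - c 1 + 6 * k ∧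
            7 * ((v + cornerUnit kk) 0 - c 0 + 6 * k) - 17 * ((v + cornerUnit kk) 1 - c 1 + 6 * k) ≤ 23 ∧
            7 * ((v + cornerUnit kk) 1 - c 1 + 6 * k) - 17 * ((v + cornerUnit kk) 0 - c 0 + 6 * k) ≤ 23) := by
    intro v hv kk hwW
    rcases hScl v hv kk hwW with h | h
    · exact Or.inl h
    · rcases hvert _ h hwW with h' | h' | h'
      · exact Or.inr (Or.inl ((hAγ _).2 h'))
      · exact Or.inr (Or.inr (Or.inl h'))
      · exact Or.inr (Or.inr (Or.inr h'))
  -- the hitting probability of `A` from `u`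
  have hhit : min circNEcwConst circNEccwConst ≤ hitProb (discreteDomainGraph D.carrier δ) S₀ A u := by
    rcases hucoord with ⟨h0, h1⟩ | ⟨h0, h1⟩
    · refine (min_le_left _ _).trans ?_
      exact shieldCore_NEcw (discreteDomainGraph D.carrier δ) S₀ A S c k hk hΘfin hSA hSS₀ hSW hSadj hcl hcross u huS
        (by rw [hc0]; omega) (by rw [hc0]; omega) (by rw [hc1]; omega) (by rw [hc1]; omega)
    · refine (min_le_right _ _).trans ?_
      exact shieldCore_NEccw (discreteDomainGraph D.carrier δ) S₀ A S c k hk hΘfin hSA hSS₀ hSW hSadj hcl hcross u huS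
        (by rw [hc0]; omega) (by rw [hc0]; omega) (by rw [hc1]; omega) (by rw [hc1]; omega)
  -- optional stopping and the Harnack bound
  have hsuper : IsKilledSuperharmonicOn (discreteDomainGraph D.carrier δ) H (S₀ \ A) :=
    (hHarm.mono fun x hx => hx.1).superharmonicOn
  have hAval : ∀ w ∈ A, H v₀ ≤ H w := by
    intro w hw
    rcases hγ w ((hAγ w).1 hw) with h | h
    · rw [h]; exact hwend
    · exact h.2
  have hstop := mul_hitProb_le_of_superharmonic (discreteDomainGraph D.carrier δ) S₀ A H (H v₀) hΘfin hm0 hH0 hsuper hAval u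
  calc min circNEcwConst circNEccwConst * H v₀ ≤ hitProb (discreteDomainGraph D.carrier δ) S₀ A u * H v₀ :=
        mul_le_mul_of_nonneg_right hhit hm0
    _ = H v₀ * hitProb (discreteDomainGraph D.carrier δ) S₀ A u := mul_comm _ _
    _ ≤ H u := hstop
    _ ≤ CH * H pp := hHar u huc0 huc1 hucap.1 hucap.2

end Summit.CriticalPhenomena.SAWScalingLimit.Theorems.AvoidanceLimit.Anchor

end
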